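import Mathlib
import HarnessLib
import HarnessLib.Audit
import Summits.KontsevichZagierPeriods.Statement
import Literature.NumberTheory.Transcendental.KZCalculus
import Literature.NumberTheory.Transcendental.KZKernelConjectureForms
import HarnessLib.Audit.Status.Attr

/-!
Route: RootDecompWalshStrata

# Route RootDecompWalshStrata — KZ via the Walsh one-inequality normal form, split by
dimension-degree strata

It suffices to show X = WalshSpan ∧ PlanarSignKernel ∧ QuadricSignKernel ∧ SignDescent (root node of
the
decomposition cell decomp-kz, lens «minimal counterexample / extremal reduction»; draft file
HOME/decomp-kz-lens-4/WalshStrata.lean, `closes` kernel-checked, 0 sorry). Normal form: a WEIGHTED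
WALSH CELL is the
representation on (0,1)ᵈ ∩ {P > 0} (P ∈ ℚ[x₁..x_d], ONE strict inequality inside the unit cube) with
constant
integrand q ∈ ℚ. WalshSpan: every KZ-rational class is congruent modulo moves to a ℤ-combination of
weighted Walsh
cells (sign-character expansion 2ᵏ·1[p₁>0..p_k>0] = Σ_T (2·1[p_T>0] − 1) a.e., p_T = ∏_T pᵢ). Given
it, Conjecture 1
⟺ SignKernel (every vanishing combination of Walsh-cell volumes is a relation = Hilbert's third
problem over ℚ for
signed hypersurface cells; `summit_iff_signKernel`), and SignKernel splits EXACTLY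
(`signKernel_iff_split`) into the
1-motive stratum PlanarSignKernel (d ≤ 2), the Artin–Tate stratum QuadricSignKernel (deg ≤ 2, all d)
and the
relative residual SignDescent (the Walsh kernel is generated modulo moves by those two strata).
ROOT DECOMPOSITION CELL decomp-kz (D-0178), generation 0, node D = lens-4 «WalshStrata»
(HOME/decomp-kz-lens-4/WalshStrata.lean v1.1 sha256
509f0f18aa08205ecb977e6486ecaad05534b784dc5b4e27883cad4ba1a59460 (v1 @135b0583; the five defs and
all theorem statements byte-identical): `node_iff` pieces ⟺ S ∧ WalshSpan, `summit_iff_signKernel :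
WalshSpan → (S ↔ SignKernel)`, the exact split `signKernel_iff_split : SignKernel ↔ PlanarSignKernel
∧ QuadricSignKernel ∧ SignDescent`, `closes`, the three `_of_summit` necessity theorems; rc 0, 0
sorry, std axioms), CLEARED by the critic decomp-kz-crit-1 v1 2026-08-30T01:54:06Z «exact mod W» and
CONFIRMED v1.1 2026-08-30T01:59:45Z (HOME/STATUS.md; HOME/CRITIC-LEDGER.md row «lens-4 WalshStrata»;
probe HOME/critic/L4_WalshStrata_v1_probe.lean rc 0, std axioms) as a 4-piece AND-node «EXACT MOD
W»: ONE EQUIV frame S ↔ SignKernel GIVEN WalshSpan (SignKernel is an aside of the lens file, not an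
item) with an EXACT split beneath; necessity.conditional = {WalshSpan} — W is THEOREM-TYPE
(transcendence-free, provable-now from tree theorems), NOT S-implied, and the node is exact on the
nose the moment W is proved (critic w3 (i)). Filed by the cell writer decomp-kz-writer-1 as an
OR-sibling of RootDecompDescentLadder / RootDecompRelativeOneConservativity /
RootDecompDimensionDescent / RootDecompRationalCubeDichotomy / RootDecompFiniteDefect (native
`closes` certification rc 0; BC2 C → S probes FAIL 4/4; BC7 4/4 CLEAN; tribunal pre-check recorded
in the writer folder; tribunal_fit.residual = SignDescent). Tags: W WalshSpan
THEOREM-TYPE·ATTACKABLE(provable-now, the hinge, rank 2) · Q QuadricSignKernel WEAKER·(d≤2 overlaps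
P | d=3 ATTACKABLE mod descent device | d=4 IDEA-NEEDED+INSTRUMENTABLE | d≥5 BARRIER-adjacent) · P
PlanarSignKernel WEAKER·ATTACKABLE(closed mod print [hand] via PlanarAreas 4990; gen-1 MUST
kernel-check the edge) · D SignDescent DECLARED-RESIDUAL(EQ9, oracle planar ∪ quadric
cells)·IDEA-NEEDED. TREE placement (critic w4): sector ∧ complement (EQ9) family, oracle = planar
cells ∪ Artin–Tate quadric cells, sibling of RootDecompRelativeOneConservativity (oracle O₁ =
relative dimension ≤ 1), oracles incomparable; cross-edges PlanarSignKernel ⟸ 4990 [hand], Q(d ≤ 2)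
⟸ PlanarSignKernel [kernel, critic probe]. census of record HOME/census/COSTUME-CENSUS-v1.md sha256
d820a1ccef7038cf1cf2195521173f232f3fb9dc74eaa204c7dee97b259d5198 (json
b41930f92fedc36ffa76fd1e9f0034d3b117c647635515f1ba8fb90c700a24cf) (rows EQ9, R1–R3 map the pieces;
the absolute finite-(n,D) Walsh-cell conjecture is NOT filed — top cell absorbing — only its
relative form SignDescent). WHY THIS IS NOVEL: the first single-inequality normal form of the summit
in the tree (weighted Walsh cells (0,1)ᵈ ∩ {P > 0} with constant ℚ-integrands, via the Walsh
sign-character expansion), in which dimension and degree can only be raised by known moves, so (d,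
deg) is an honest bidegree of a minimal counterexample and «degree ≤ 2 in every dimension» becomes a
typed, S-implied, Artin–Tate piece of Conjecture 1 beside the 1-motive stratum — with the hinge W a
provable theorem rather than a conjecture. Rung currency: rung 0 — nothing here proves the summit.
Lean: `Summit.KontsevichZagierPeriods.KontsevichZagierPeriods.Theses.RootDecompWalshStrata.WalshSpan
∧
Summit.KontsevichZagierPeriods.KontsevichZagierPeriods.Theses.RootDecompWalshStrata.PlanarSignKernel
∧
Summit.KontsevichZagierPeriods.KontsevichZagierPeriods.Theses.RootDecompWalshStrata.QuadricSignKernel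
∧ Summit.KontsevichZagierPeriods.KontsevichZagierPeriods.Theses.RootDecompWalshStrata.SignDescent`

## Assembly
Pure logic plus two tree facts (relations evaluate to 0: KZ.relations_le_ker_eval_holds;
AddSubgroup.closure_le):
Walsh-span r and r′ over a common family, subtract — the coefficient difference is a Walsh kernel
combination —,
descend it by SignDescent into the subgroup generated by relations and the two low strata, collapse
that subgroup
onto KZ.relations with PlanarSignKernel and QuadricSignKernel, and reassemble [r] − [r′].
Kernel-checked as `closes`
(axioms propext, Classical.choice, Quot.sound).

Rationale: WHY THIS LINE. A counterexample to Conjecture 1 is a kernel class outside the move subgroup; the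
lens asks for a normal form in
which some complexity cannot be lowered by any known move, and then reads the minimal stratum. In
every frame used
so far (dimension ladders KzOnePeriodsLadder / AbelContraction / lens-1 / lens-6, fibre dimension
lens-3, volume and
compact normal forms ViuSos2021, degree HodgeColevel) the complexity is compressible (HodgeColevel's
DegreeCompression ≡ S) or the cut is by dimension alone; in the Walsh frame (one inequality, cube
walls free,
rational weights absorbing dyadic factors and homotheties) dimension and degree can only be RAISED
by known moves
(pad a variable; multiply P by 1 + x₁²), so (d, deg) is an honest bidegree of a minimal
counterexample. Its two
lowest strata are exactly the two period engines that exist: d ≤ 2 = incomplete abelian integrals =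
1-periods,
decided by HuberWustholz2022 Thm 13.3 (tree: PlanarAreas stmt-KontsevichZagierPeriods-4990 PROVED
modulo the named
fact HuberWustholzCurvePeriods); deg ≤ 2 in any dimension = cellular pairs (ℙᵈ ∖ quadric, coordinate
walls) =
mixed Artin–Tate periods (DeligneGoncharov2005, Goncharov1999, HuberMullerStach2017 Ch. 15), whose
weight grows at
half speed (d ≤ 3 weight ≤ 1: Baker1975; d = 4: π²/32, dilogarithms). Imported: Walsh–Fourier
expansion on {±1}ᵏ
(harmonic analysis of Boolean functions) for the normal form; mixed Tate motives / scissors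
congruence
(Goncharov1999, arXiv:1910.07112) for the quadric stratum; 1-motives (HuberWustholz2022) for the
planar stratum.
What it does that prior routes do not: the first single-inequality normal form in the tree, a typed
Artin–Tate
piece of Conjecture 1 in ALL dimensions, and a residual whose oracle (planar ∪ quadric cells) is
incomparable with
every recorded residual (14403, lens-1 KernelDescentTwo, lens-3 KZModRelativeOne, lens-6
DescentFrom).

RANKED CRUXES. #2 WalshSpan (crux) — [ROOT-DECOMP decomp-kz gen 0 · node D piece W · tag
THEOREM-TYPE / UNDECIDED(test: prove it — transcendence-free) → the HINGE: node exact MOD W,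
necessity.conditional = {WalshSpan} (kernel identity of record `node_iff` : pieces ⟺ S ∧ WalshSpan;
`critic_W_load`: the three kernel pieces alone give only W → S); W is NOT S-implied; the critic
checked the Walsh weight bookkeeping ([D,1] ≡ Σ_T ±([{p_T>0},2^{1−k}] − [cube,2^{−k}]) needs only
integrand additivity on atoms, no integer division) and concurs it is provable-now from tree
theorems (Viu-Sos compact-volume reduction, rational homothety, finiteness theorem, signed scissors
with constant ℚ-weights, walsh_two) · NECESSARY (binder hW of `closes`; ranked FIRST per critic w1 —
it is the hinge) · NEW (first single-inequality normal form in the tree) · leaf ATTACKABLE(M,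
provable-now; formalisation-size risk only) · census of record HOME/census/COSTUME-CENSUS-v1.md
sha256 d820a1ccef7038cf1cf2195521173f232f3fb9dc74eaa204c7dee97b259d5198 (json
b41930f92fedc36ffa76fd1e9f0034d3b117c647635515f1ba8fb90c700a24cf) · verdict: critic decomp-kz-crit-1
CLEARED v1 2026-08-30T01:54:06Z «exact mod W» and CONFIRMED v1.1 2026-08-30T01:59:45Z
(HOME/STATUS.md; HOME/CRITIC-LEDGER.md row «lens-4 WalshStrata»; probe
HOME/critic/L4_WalshStrata_v1_probe.lean rc 0, std axioms)] THEOREM-TYPE / UNDECIDED(test: prove it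
— transcendence-free; the hinge: node exact mod this piece, necessity.conditional = {WalshSpan}).
WALSH SPANNING in common-refinement form: for any two KZ-rational representations r, r′ there are
one finite family of weighted Walsh cells ρᵢ (domain (0,1)^(dᵢ) ∩ {Pᵢ > 0}, constant integrand qᵢ ∈
ℚ) and integer vectors c, c′ with [r] − Σ cᵢ[ρᵢ] ∈ KZ.relations and [r′] − Σ c′ᵢ[ρᵢ] ∈ KZ.relations.
Inputs, all in the tree: hypograph/compactification normal form (ViuSos2021, KZMonomialCompression /
KZSemiCanonicalReduction PROVED), signed scissors (SymplecticScissors.LogPolytope.stub_scissors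
PROVED; constant-weight variant via integrandAddRel), finiteness theorem
isSemialgebraic_iff_exists_finset_basic_holds, null zero sets, the Walsh identity (walsh_two in the
draft), rational homothety into the cube. [difficulty: provable-now] (why it might fail:
Mathematically it cannot (elementary measure theory + KZ rules (1),(2)); the risk is formalisation
size: building the cells as IntegralReps (semialgebraicity, integrability side conditions) and
inclusion–exclusion over the atoms of a sign-condition Boolean algebra.) [KontsevichZagier2001,
ViuSos2021, CressonViusos2022]
#3 QuadricSignKernel (crux) — [ROOT-DECOMP decomp-kz gen 0 · node D piece Q · tag WEAKER — S ⟹ Q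
(`quadricSignKernel_of_summit`), Q ⟹ S NOT known; BC2 probe Q → S FAILS; absorbing? UNDECIDED with
stated test (cheapest falsifier: a degree-lowering change of variables for a generic cubic Walsh
cell; critic concurs with the cellularity argument AGAINST absorption: every stratum of (ℙᵈ∖Q,
coordinate flats ∪ unit translates) is a quadric complement/cone or linear ⟹ cell volumes are mixed
ARTIN–TATE periods, so absorption would put ω₁(E) in their span — GPC(E)-level contradiction) ·
OVERLAP recorded: the d ≤ 2 sub-leaf is already inside PlanarSignKernel
(`critic_planar_covers_quadric_lowdim`, kernel) — new content starts at d = 3 · NECESSARY (binder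
hQ) · NEW (a typed Artin–Tate piece of Conjecture 1 in ALL dimensions) · leaves: d = 3
ATTACKABLE(mod a descent device INSIDE the calculus — values weight ≤ 1 (Baker) but the naive
Newton–Leibniz route with √/log/arcsin primitives is the technique class of
Literature.Barriers.KontsevichZagierPeriods.noSemialgebraicPrimitive_inv_sub_two; ≈ lens-1/6 rungs
AreaDescentTwo 23648 / DescentThree 24769 restricted to quadric cells) · d = 4 IDEA-NEEDED +
INSTRUMENTABLE (π²/32, Li₂: the weight-2 wall; quadric cell census instrument) · d ≥ 5
BARRIER-adjacent (GPC dependence) · verdict: critic decomp-kz-crit-1 CLEARED v1 2026-08-30T01:54:06Z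
«exact mod W» and CONFIRMED v1.1 2026-08-30T01:59:45Z (HOME/STATUS.md; HOME/CRITIC-LEDGER.md row
«lens-4 WalshStrata»; probe HOME/critic/L4_WalshStrata_v1_probe.lean rc 0, std axioms)] WEAKER — the
ARTIN–TATE STRATUM. A vanishing ℤ-combination of values of weighted Walsh cells (0,1)^(dᵢ) ∩ {Pᵢ >
0} with every Pᵢ of total degree ≤ 2 (any dimensions dᵢ, rational constant integrands) is a relation
of the KZ calculus. S ⟹ it (`quadricSignKernel_of_summit`); converse unknown (its values are mixed
Artin–Tate periods only). Leaves: d ≤ 2 overlaps PlanarSignKernel (new content from d = 3); d = 3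
attackable mod a descent device inside the calculus (values weight ≤ 1, Baker; naive Newton–Leibniz
primitives fall in AlgebraicPrimitivesObstruction's class), d = 4 idea-needed (π²/32, dilogarithms),
d ≥ 5 barrier-adjacent. [difficulty: XL] (why it might fail: Implied by S, so not refutable alone;
it dies AS A CUT if a change of variables lowers generic cubic Walsh cells to quadric combinations
(then it is ≡ S, absorbing); for d ≥ 5 its instances reach multiple polylogarithms where no chain
template is known.) [DeligneGoncharov2005, Goncharov1999, Baker1975, arXiv:1910.07112,
KontsevichZagier2001]
#4 PlanarSignKernel (crux) — [ROOT-DECOMP decomp-kz gen 0 · node D piece P · tag WEAKER — S ⟹ P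
(`planarSignKernel_of_summit`), P ⟹ S NOT known (= dimension descent to planar cells, open); BC2
probe P → S FAILS · NECESSARY (binder hP) · leaf ATTACKABLE — «closed mod print» ONLY [hand]: the
edge PlanarAreas (item stmt-KontsevichZagierPeriods-4990, PROVED modulo the named fact
HuberWustholzCurvePeriods, print gap G-D1) ⟹ PlanarSignKernel (weight clearing N·x, padding 0/1 → 2,
sign split + disjoint translated copies into ONE region each side, PlanarAreas, integer division
`mem_relations_of_nsmul_mem`) is NOT kernel-checked in the lens file — critic w2: gen-1 MUST land
`planarSignKernel_of_planarAreas` so that P hangs under 4990 ∧ HuberWustholzCurvePeriods exactly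
like RootDecompDescentLadder.PlanarAreas / the KZ_le 1 sub-layer · verdict: critic decomp-kz-crit-1
CLEARED v1 2026-08-30T01:54:06Z «exact mod W» and CONFIRMED v1.1 2026-08-30T01:59:45Z
(HOME/STATUS.md; HOME/CRITIC-LEDGER.md row «lens-4 WalshStrata»; probe
HOME/critic/L4_WalshStrata_v1_probe.lean rc 0, std axioms)] WEAKER — the 1-MOTIVE STRATUM. A
vanishing ℤ-combination of values of weighted Walsh cells of dimension ≤ 2 (areas of (0,1)² ∩ {P >
0} with rational weights) is a relation of the KZ calculus. S ⟹ it (`planarSignKernel_of_summit`);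
converse unknown; follows from PlanarAreas (stmt-KontsevichZagierPeriods-4990, PROVED modulo the
named fact HuberWustholzCurvePeriods) by padding, translation, domain additivity and integer
division (MzvKernelInKZ.Negative.mem_relations_of_nsmul_mem, PROVED) — this edge is [hand], not yet
kernel-checked (gen-1 MUST). [difficulty: M] (why it might fail: Only through the print gap behind
HuberWustholzCurvePeriods (HW Thm 13.3(2) rendering, gap G-D1); the glue from PlanarAreas (dimension
exactly 2, integrand 1) to weighted cells of dimension ≤ 2 is routine but must be written.)
[HuberWustholz2022, KontsevichZagier2001, arXiv:2204.01402]
#5 SignDescent (crux) — [ROOT-DECOMP decomp-kz gen 0 · node D piece D · tag DECLARED-RESIDUAL (EQ9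
kind: S mod the oracle O = vanishing planar-or-quadric Walsh combinations; S ⟹ it
(`signDescent_of_summit`), kernel; NOT sold as weaker-by-evidence;
`signDescent_implies_conditional`: it ⟹ (W → P → Q → S)); tribunal_fit.residual = this decl (critic
w1); carries everything non-Artin–Tate of dimension ≥ 3 (first honest cell (d,deg) = (3,3): boundary
strata are plane cubics = elliptic) · shrink vs the recorded residuals 14403 / 18030 /
RootDecompDescentLadder.KernelDescentTwo 23649 /
RootDecompRelativeOneConservativity.KZModRelativeOne 24332 / RootDecompDimensionDescent.DescentFrom
24771: INCOMPARABLE (rational integrands over planar domains Walsh-normalise to 3-cells) — accepted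
as stated; critic w3 scores gen 1 by a certified shrink (e.g. 14403 ⟹ it via a planar Walsh form of
1-dimensional rational representations) or a first rung cut out of it · NECESSARY (binder hD) · leaf
IDEA-NEEDED / BARRIER-adjacent (GPC dependence, undecidability scope) · verdict: critic
decomp-kz-crit-1 CLEARED v1 2026-08-30T01:54:06Z «exact mod W» and CONFIRMED v1.1
2026-08-30T01:59:45Z (HOME/STATUS.md; HOME/CRITIC-LEDGER.md row «lens-4 WalshStrata»; probe
HOME/critic/L4_WalshStrata_v1_probe.lean rc 0, std axioms)] DECLARED-RESIDUAL (relative form; writer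
kind residual, EQ9 family). Every vanishing ℤ-combination of weighted Walsh-cell values lies in the
subgroup of formal combinations generated by KZ.relations together with the vanishing combinations
of planar (all dᵢ ≤ 2) or quadric (all deg Pᵢ ≤ 2) weighted Walsh cells. S ⟹ it
(`signDescent_of_summit`); it ⟹ (WalshSpan → PlanarSignKernel → QuadricSignKernel → S) (`closes`);
converse unknown; leaf IDEA-NEEDED. [difficulty: open-problem] (why it might fail: As typed it is
implied by S, so it cannot fail unless S does; as a USEFUL cut it fails if no (d,deg)-lowering
mechanism exists off the two low strata — it is summit-hard on the top stratum by design (declared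
residual).) [KontsevichZagier2001, DeligneGoncharov2005, HuberWustholz2022]

TWO-LAYER PLAN. QuadricSignKernel ⇐ QuadricLowDim (all dᵢ ≤ 3: weight ≤ 1, Baker) →
QuadricDescentFour (d ≥ 4 modulo d ≤ 3) → QuadricSignKernel;
SignDescent ⇐ a planar Walsh normal form for 1-dimensional rational representations →
(AbelContraction.ReductionToDimensionOne
stmt-14403 → SignDescent), the certified shrink below the recorded residual, gen 1. GEN-2/GEN-3
STATE (lens-4 v2 @ee96b5e7 critic CONFIRMED, census K19; v3 @59ab03df critic CONFIRMED
2026-08-30T04:20:26Z, HOME/decomp-kz-lens-4/WalshStrata.lean 2617 lines rc 0 / 0 sorry / std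
axioms): WalshSpan 25395 (the hinge) is PROVED in the lens (walshSpan_holds; Theorems proposals in
flight from the census seat, 1/3 p759870) ⟹ node D is EXACT with three open pieces
(QuadricSignKernel 25393, PlanarSignKernel 25394, SignDescent 25392 residual). New rank-9 SUPPORT
items (v3, critic w2): QuadricThree 27596 = the rung d ≤ 3 of QuadricSignKernel (WEAKER; S ⟹ it)
reduced OUTRIGHT, kernel-checked, to the moves-only support QuadricBakerDescent 27597 (every
weighted quadric Walsh cell of dimension ≤ 3 is congruent mod KZ.relations to an element of the
Baker sector closure{of N : dim N ≤ 1, N.IsRational}) by quadricThree_of_bakerDescent : BakerKernel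
→ QuadricBakerDescent → QuadricThree, BakerKernel being the tree theorem
PiBox.Dlog.mem_relations_of_eval_eq_zero_of_dim_le_one (input by name, not an item) — i.e. the
transcendence content of the whole d = 3 quadric leaf is exactly BAKER (critic structural remark
03:42Z made literal); first pieces of the quadric stratum DECIDED INSIDE THE RULES:
coneRung_mem_relations (3·[(0,1)³∩{z²>x²+y²},1] − [(0,1)³∩{1>x²+y²},1] ∈ KZ.relations) and
cone_bakerDescent ([cone,1] ≡ [(0,1), 8t²/(3(1+t²)³)] by six moves) — INSTRUMENT for Q at d = 3
(lens file attached as evidence on 27597/27596); honest frontier of Q then starts at d = 4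
(dilogarithmic periods). Landing targets (prover seats):
Theorems/RootDecompWalshStrataConeSpecimen*.lean --supports 27597; quadricThree_of_bakerDescent port
--supports 27596. Score g4 (critic w3): QuadricBakerDescent for d = 2 in full (one symbolic conic)
or the ball octant with a pointless radius.

KILL CRITERIA. A refutation of WalshSpan (impossible mathematically; a typing error would show as a
refutation of the cell
condition) forces a restatement, not a close. A degree-lowering change of variables turning generic
cubic Walsh
cells into quadric combinations makes QuadricSignKernel ≡ S and retires the STRATIFICATION (pivot:
keep the normal
form, cut by dimension of the cell only). PlanarSignKernel closes when stmt-4990's print gap closes.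
Nothing here can
be refuted without refuting S except WalshSpan.

NOT DECOMPOSED YET. The d-grading inside QuadricSignKernel (d ≤ 2 / 3 / 4 / ≥ 5) and the
(d,deg)-lexicographic descent candidates inside
SignDescent (product structure KZProductIdeal: the Walsh form is multiplicative, {P(x)P′(y) > 0} is
again one
inequality) are layer-2 children, filed only after WalshSpan is proved.

CHEAPEST FALSIFIER. Exhibit a KZ move lowering the degree of a generic cubic Walsh cell {P > 0} ∩
(0,1)³, deg P = 3, to a combination of
quadric cells (searched the four rule families by hand: algebraic changes of variables preserving
the cube raise
degree generically; Stokes needs a primitive, which leaves constant integrands; none found). Second: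
the quadric
cell census (Numbers) finding an integer relation among quadric-cell volumes with no chain — an
instance refuting
QuadricSignKernel would refute S itself.

NUMBERS. Quadric cell census seeds (by hand): vol{1−x²−y²−z²>0}∩(0,1)³ = π/6; vol{z²−x²−y²>0} = π/12
(so [ball cell] − 2[cone
cell] ∈ ker, chain = Cavalieri by moves); vol{z−xy>0} = 3/4; vol{yz−x²>0} = 4/9; vol{z²−xy>0} = 5/9;
vol(orthant of B⁴)
= π²/32 (d = 4, weight 2). Instrument for decomp-kz-census-1: integer quadrics in 3–4 variables,
coefficients in
[−2,2], volumes to 30 digits, PSLQ against {1, π, π², log 2, log 3, π log 2, √2, √3, √5, log(1+√2),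
log((1+√5)/2)}.

DEFINITION REQUESTS. None: weighted Walsh cells are inlined as a condition on KZ.IntegralRep (domain
= cube ∩ {P > 0}, integrand = q).

Novelty: Searches (2026-08-30): lean search / rg over the 99 Theses of the summit for "sign condition|single
inequality|Walsh|one inequality|totalDegree ≤ 2" (0 normal-form hits; BoundaryLevel cubic skins and
SphericalSchlafli orthoschemes nearest); ledger negatives --problem KontsevichZagierPeriods (1
entry, unrelated); lit search --hybrid "volume of semialgebraic set defined by one polynomial
inequality sign pattern inclusion exclusion" (6 docs: Basu–Pollack–Roy sign conditions, van den
Dries — no period statement); lit search --hybrid "Hilbert third problem scissors congruence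
semialgebraic sets volume preserving Kontsevich Zagier" (arXiv:2204.01402 Huber, period isomorphism
in tame geometry); lit galaxy search "scissors congruence|semialgebraic scissors|semi-algebraic
scissors" --star all (16 rows: Dehn–Sydler, Hesselholt notes, arXiv:1910.07112 Campbell–Zakharevich
Hilbert 3 and Goncharov's conjecture).
Nearest prior art found: Goncharov1999 / arXiv:1910.07112 (scissors congruence of
hyperbolic/spherical polytopes ↔ mixed Tate motives: the quadric-stratum philosophy, for geodesic
simplices, not for Walsh cells or the KZ move calculus); ViuSos2021 (volume normal form, several
inequalities); in tree Theses/BoundaryLevel (cubic skins N = 3,4) and Theses/HodgeColevel (degree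
compression ≡ S in the unconstrained frame).
Delta: normalising to ONE inequality with free cube walls makes degree non-compressible, which turns
"degree ≤ 2 in every dimension" into a typed, S-implied, Artin–Tat  [refs: 2204.01402, 1910.07112, Goncharov1999, ViuSos2021]

Barriers (technique_class: normal-form, scissors-congruence, mixed-tate): - technique_class: normal-form, scissors-congruence, mixed-tate
- Literature.Barriers.KontsevichZagierPeriods.kzConjecture_implies_oddZetaAlgIndep:
(GrothendieckPeriodConjectureDependence, with kzConjecture_implies_twoPiI_log_algIndep and
kzConjecture_implies_ellipticPeriods_algIndep) PlanarSignKernel sits inside the proved 1-motive case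
(Huber–Wüstholz), outside the barrier; QuadricSignKernel for d ≤ 3 sits in weight ≤ 1 (Baker),
outside; d ≥ 5 quadric cells and SignDescent sit inside the barrier's scope (odd zeta values are
volumes of such cells) — it does not evade it there; the bet is that the Artin–Tate stratum is the
one place where the period conjecture is closest to known (Deligne–Goncharov, Brown's mixed Tate
theorem) and chains can be instrumented.
- Literature.Barriers.KontsevichZagierPeriods.noSemialgebraicPrimitive_inv_sub_two:
(AlgebraicPrimitivesObstruction, with algebraicPrimitivesObstructionNarrow) the normal form uses
only rules (1),(2) with algebraic changes of variables and constant integrands — no Newton–Leibniz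
primitives are taken, so the obstruction does not quantify over WalshSpan; it bites inside
SignDescent/QuadricSignKernel d ≥ 4 exactly where weight ≥ 2 (declared).
- Literature.Barriers.KontsevichZagierPeriods.cressonViuSos_prop_3_2: (HauptvermutungObstruction)
the Walsh normal form never asks for a GLOBAL semialgebraic map between two representations —
scissors (domain additivity) is the first ingredient of WalshSpan and of every chain, so the ob

sub-problem: KontsevichZagierPeriods · status: draft · opened planner-decomp-kz-writer-1-g0-0 2026-08-30T02:33:41Z · rev 1 · ledger route-KontsevichZagierPeriods-RootDecompWalshStrata
GENERATED by the gate from the ledger (D-0016/17). Provers cite these decls: `theorem foo : Summit.KontsevichZagierPeriods.KontsevichZagierPeriods.Theses.RootDecompWalshStrata.<Decl> := …` in Summits/KontsevichZagierPeriods/KontsevichZagierPeriods/Theorems/<Name>.lean.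
-/

namespace Summit.KontsevichZagierPeriods.KontsevichZagierPeriods.Theses.RootDecompWalshStrata

open scoped BigOperators Topology Manifold Classical MeasureTheory ProbabilityTheory Matrix InnerProductSpace ComplexConjugate ContinuousMap
open Filter Set Function TopologicalSpace MeasureTheory

attribute [summit_statement] _root_.KontsevichZagierPeriods

open Literature Periods

/-- item stmt-KontsevichZagierPeriods-25395 · crux · rank 2 · closed · proved by Summit.KontsevichZagierPeriods.RootDecompWalshStrata.WalshSpanProof.walshSpan_proof (prover) · by planner
why it might fail: Mathematically it cannot (elementary measure theory + KZ rules (1),(2)); the risk is formalisation size: building the cells as IntegralReps (semialgebraicity, integrability side conditions) and inclusion–exclusion over the atoms of a sign-condition Boolean algebra.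
sources: KontsevichZagier2001, ViuSos2021, CressonViusos2022
[crux] [ROOT-DECOMP decomp-kz gen 0 · node D piece W · tag THEOREM-TYPE / UNDECIDED(test: prove it —
transcendence-free) → the HINGE: node exact MOD W, necessity.conditional = {WalshSpan} (kernel
identity of record `node_iff` : pieces ⟺ S ∧ WalshSpan; `critic_W_load`: the three kernel pieces
alone give only W → S); W is NOT S-implied; the critic checked the Walsh weight bookkeeping ([D,1] ≡
Σ_T ±([{p_T>0},2^{1−k}] − [cube,2^{−k}]) needs only integrand additivity on atoms, no integer
division) and concurs it is provable-now from tree theorems (Viu-Sos compact-volume reduction,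
rational homothety, finiteness theorem, signed scissors with constant ℚ-weights, walsh_two) ·
NECESSARY (binder hW of `closes`; ranked FIRST per critic w1 — it is the hinge) · NEW (first
single-inequality normal form in the tree) · leaf ATTACKABLE(M, provable-now; formalisation-size
risk only) · census of record HOME/census/COSTUME-CENSUS-v1.md sha256
d820a1ccef7038cf1cf2195521173f232f3fb9dc74eaa204c7dee97b259d5198 (json
b41930f92fedc36ffa76fd1e9f0034d3b117c647635515f1ba8fb90c700a24cf) · verdict: critic decomp-kz-crit-1
CLEARED v1 2026-08-30T01:54:06Z «exact mod W» and CONFIRMED v1.1 2026-08-30T01:59:45Z (HOME -/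
@[route_item "route-KontsevichZagierPeriods-RootDecompWalshStrata", crux]
def WalshSpan : Prop :=
  ∀ ⦃n m : ℕ⦄ (r : Literature.NumberTheory.Transcendental.KZ.IntegralRep n) (r' : Literature.NumberTheory.Transcendental.KZ.IntegralRep m), r.IsRational → r'.IsRational → ∃ (k : ℕ) (d : Fin k → ℕ) (P : (i : Fin k) → MvPolynomial (Fin (d i)) ℚ) (q : Fin k → ℚ) (ρ : (i : Fin k) → Literature.NumberTheory.Transcendental.KZ.IntegralRep (d i)) (c c' : Fin k → ℤ), (∀ i, (ρ i).domain = {x | (∀ j, 0 < x j ∧ x j < 1) ∧ 0 < MvPolynomial.aeval x (P i)} ∧ ∀ x ∈ (ρ i).domain, (ρ i).integrand x = (q i : ℝ)) ∧ Literature.NumberTheory.Transcendental.KZ.of r - ∑ i, c i • Literature.NumberTheory.Transcendental.KZ.of (ρ i) ∈ Literature.NumberTheory.Transcendental.KZ.relations ∧ Literature.NumberTheory.Transcendental.KZ.of r' - ∑ i, c' i • Literature.NumberTheory.Transcendental.KZ.of (ρ i) ∈ Literature.NumberTheory.Transcendental.KZ.relations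

-- `WalshSpan` holds: proved by `Summit.KontsevichZagierPeriods.RootDecompWalshStrata.WalshSpanProof.walshSpan_proof` (its module imports this route file, so no `_holds` link can be stated here).

/-- item stmt-KontsevichZagierPeriods-25393 · crux · rank 3 · open · by planner
why it might fail: Implied by S, so not refutable alone; it dies AS A CUT if a change of variables lowers generic cubic Walsh cells to quadric combinations (then it is ≡ S, absorbing); for d ≥ 5 its instances reach multiple polylogarithms where no chain template is known.
sources: DeligneGoncharov2005, Goncharov1999, Baker1975, arXiv:1910.07112, KontsevichZagier2001
[crux] [ROOT-DECOMP decomp-kz gen 0 · node D piece Q · tag WEAKER — S ⟹ Q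
(`quadricSignKernel_of_summit`), Q ⟹ S NOT known; BC2 probe Q → S FAILS; absorbing? UNDECIDED with
stated test (cheapest falsifier: a degree-lowering change of variables for a generic cubic Walsh
cell; critic concurs with the cellularity argument AGAINST absorption: every stratum of (ℙᵈ∖Q,
coordinate flats ∪ unit translates) is a quadric complement/cone or linear ⟹ cell volumes are mixed
ARTIN–TATE periods, so absorption would put ω₁(E) in their span — GPC(E)-level contradiction) ·
OVERLAP recorded: the d ≤ 2 sub-leaf is already inside PlanarSignKernel
(`critic_planar_covers_quadric_lowdim`, kernel) — new content starts at d = 3 · NECESSARY (binder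
hQ) · NEW (a typed Artin–Tate piece of Conjecture 1 in ALL dimensions) · leaves: d = 3
ATTACKABLE(mod a descent device INSIDE the calculus — values weight ≤ 1 (Baker) but the naive
Newton–Leibniz route with √/log/arcsin primitives is the technique class of
Literature.Barriers.KontsevichZagierPeriods.noSemialgebraicPrimitive_inv_sub_two; ≈ lens-1/6 rungs
AreaDescentTwo 23648 / DescentThree 24769 restricted to quadric cells) · d = 4 IDEA-NEEDED +
INSTRUMENTABLE (π²/3 -/
@[route_item "route-KontsevichZagierPeriods-RootDecompWalshStrata", crux]
def QuadricSignKernel : Prop :=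
  ∀ (k : ℕ) (d : Fin k → ℕ) (P : (i : Fin k) → MvPolynomial (Fin (d i)) ℚ) (q : Fin k → ℚ) (ρ : (i : Fin k) → Literature.NumberTheory.Transcendental.KZ.IntegralRep (d i)) (c : Fin k → ℤ), (∀ i, (ρ i).domain = {x | (∀ j, 0 < x j ∧ x j < 1) ∧ 0 < MvPolynomial.aeval x (P i)} ∧ ∀ x ∈ (ρ i).domain, (ρ i).integrand x = (q i : ℝ)) → (∀ i, (P i).totalDegree ≤ 2) → Literature.NumberTheory.Transcendental.KZ.eval (∑ i, c i • Literature.NumberTheory.Transcendental.KZ.of (ρ i)) = 0 → (∑ i, c i • Literature.NumberTheory.Transcendental.KZ.of (ρ i)) ∈ Literature.NumberTheory.Transcendental.KZ.relations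

/-- item stmt-KontsevichZagierPeriods-25394 · crux · rank 4 · open · by planner
why it might fail: Only through the print gap behind HuberWustholzCurvePeriods (HW Thm 13.3(2) rendering, gap G-D1); the glue from PlanarAreas (dimension exactly 2, integrand 1) to weighted cells of dimension ≤ 2 is routine but must be written.
sources: HuberWustholz2022, KontsevichZagier2001, arXiv:2204.01402
[crux] [ROOT-DECOMP decomp-kz gen 0 · node D piece P · tag WEAKER — S ⟹ P
(`planarSignKernel_of_summit`), P ⟹ S NOT known (= dimension descent to planar cells, open); BC2
probe P → S FAILS · NECESSARY (binder hP) · leaf ATTACKABLE — «closed mod print» ONLY [hand]: the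
edge PlanarAreas (item stmt-KontsevichZagierPeriods-4990, PROVED modulo the named fact
HuberWustholzCurvePeriods, print gap G-D1) ⟹ PlanarSignKernel (weight clearing N·x, padding 0/1 → 2,
sign split + disjoint translated copies into ONE region each side, PlanarAreas, integer division
`mem_relations_of_nsmul_mem`) is NOT kernel-checked in the lens file — critic w2: gen-1 MUST land
`planarSignKernel_of_planarAreas` so that P hangs under 4990 ∧ HuberWustholzCurvePeriods exactly
like RootDecompDescentLadder.PlanarAreas / the KZ_le 1 sub-layer · verdict: critic decomp-kz-crit-1
CLEARED v1 2026-08-30T01:54:06Z «exact mod W» and CONFIRMED v1.1 2026-08-30T01:59:45Z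
(HOME/STATUS.md; HOME/CRITIC-LEDGER.md row «lens-4 WalshStrata»; probe
HOME/critic/L4_WalshStrata_v1_probe.lean rc 0, std axioms)] WEAKER — the 1-MOTIVE STRATUM. A
vanishing ℤ-combination of values of weighted Walsh cells of dimension ≤ 2 (areas of (0,1)² ∩ {P >
0} -/
@[route_item "route-KontsevichZagierPeriods-RootDecompWalshStrata", crux]
def PlanarSignKernel : Prop :=
  ∀ (k : ℕ) (d : Fin k → ℕ) (P : (i : Fin k) → MvPolynomial (Fin (d i)) ℚ) (q : Fin k → ℚ) (ρ : (i : Fin k) → Literature.NumberTheory.Transcendental.KZ.IntegralRep (d i)) (c : Fin k → ℤ), (∀ i, (ρ i).domain = {x | (∀ j, 0 < x j ∧ x j < 1) ∧ 0 < MvPolynomial.aeval x (P i)} ∧ ∀ x ∈ (ρ i).domain, (ρ i).integrand x = (q i : ℝ)) → (∀ i, d i ≤ 2) → Literature.NumberTheory.Transcendental.KZ.eval (∑ i, c i • Literature.NumberTheory.Transcendental.KZ.of (ρ i)) = 0 → (∑ i, c i • Literature.NumberTheory.Transcendental.KZ.of (ρ i)) ∈ Literature.NumberTheory.Transcendental.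KZ.relations

/-- item stmt-KontsevichZagierPeriods-25392 · crux · rank 5 · open · by planner
why it might fail: As typed it is implied by S, so it cannot fail unless S does; as a USEFUL cut it fails if no (d,deg)-lowering mechanism exists off the two low strata — it is summit-hard on the top stratum by design (declared residual).
sources: KontsevichZagier2001, DeligneGoncharov2005, HuberWustholz2022
[crux] [ROOT-DECOMP decomp-kz gen 0 · node D piece D · tag DECLARED-RESIDUAL (EQ9 kind: S mod the
oracle O = vanishing planar-or-quadric Walsh combinations; S ⟹ it (`signDescent_of_summit`), kernel;
NOT sold as weaker-by-evidence; `signDescent_implies_conditional`: it ⟹ (W → P → Q → S));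
tribunal_fit.residual = this decl (critic w1); carries everything non-Artin–Tate of dimension ≥ 3
(first honest cell (d,deg) = (3,3): boundary strata are plane cubics = elliptic) · shrink vs the
recorded residuals 14403 / 18030 / RootDecompDescentLadder.KernelDescentTwo 23649 /
RootDecompRelativeOneConservativity.KZModRelativeOne 24332 / RootDecompDimensionDescent.DescentFrom
24771: INCOMPARABLE (rational integrands over planar domains Walsh-normalise to 3-cells) — accepted
as stated; critic w3 scores gen 1 by a certified shrink (e.g. 14403 ⟹ it via a planar Walsh form of
1-dimensional rational representations) or a first rung cut out of it · NECESSARY (binder hD) · leaf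
IDEA-NEEDED / BARRIER-adjacent (GPC dependence, undecidability scope) · verdict: critic
decomp-kz-crit-1 CLEARED v1 2026-08-30T01:54:06Z «exact mod W» and CONFIRMED v1.1
2026-08-30T01:59:45Z (HOME/STATUS.md; HOME/CRITIC-LEDGER.md r -/
@[route_item "route-KontsevichZagierPeriods-RootDecompWalshStrata", crux]
def SignDescent : Prop :=
  ∀ (k : ℕ) (d : Fin k → ℕ) (P : (i : Fin k) → MvPolynomial (Fin (d i)) ℚ) (q : Fin k → ℚ) (ρ : (i : Fin k) → Literature.NumberTheory.Transcendental.KZ.IntegralRep (d i)) (c : Fin k → ℤ), (∀ i, (ρ i).domain = {x | (∀ j, 0 < x j ∧ x j < 1) ∧ 0 < MvPolynomial.aeval x (P i)} ∧ ∀ x ∈ (ρ i).domain, (ρ i).integrand x = (q i : ℝ)) → Literature.NumberTheory.Transcendental.KZ.eval (∑ i, c i • Literature.NumberTheory.Transcendental.KZ.of (ρ i)) = 0 → (∑ i, c i • Literature.NumberTheory.Transcendental.KZ.of (ρ i)) ∈ AddSubgroup.closure ((Literature.NumberTheory.Transcendental.KZ.relations : Set Literature.NumberTheory.Transcendental.KZ.FormalRep)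 ∪ {f | ∃ (k' : ℕ) (d' : Fin k' → ℕ) (P' : (i : Fin k') → MvPolynomial (Fin (d' i)) ℚ) (q' : Fin k' → ℚ) (ρ' : (i : Fin k') → Literature.NumberTheory.Transcendental.KZ.IntegralRep (d' i)) (c' : Fin k' → ℤ), (∀ i, (ρ' i).domain = {x | (∀ j, 0 < x j ∧ x j < 1) ∧ 0 < MvPolynomial.aeval x (P' i)} ∧ ∀ x ∈ (ρ' i).domain, (ρ' i).integrand x = (q' i : ℝ)) ∧ ((∀ i, d' i ≤ 2) ∨ (∀ i, (P' i).totalDegree ≤ 2)) ∧ Literature.NumberTheory.Transcendental.KZ.eval f = 0 ∧ f = ∑ i, c' i • Literature.NumberTheory.Transcendental.KZ.of (ρ' i)})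

/-- item stmt-KontsevichZagierPeriods-27596 · support · rank 9 · open · by planner
[support] [ROOT-DECOMP decomp-kz gen 3 · node D (route of record RootDecompWalshStrata) · lens-4
«WalshStrata» v3 @59ab03df (HOME/decomp-kz-lens-4/WalshStrata.lean l.1739, 2617 lines, rc 0 / 0
sorry / std axioms) · critic decomp-kz-crit-1 CLEARED/CONFIRMED 2026-08-30T04:20:26Z (w2): RUNG d ≤
3 of QuadricSignKernel 25393 — QUADRIC STRATUM IN DIMENSION ≤ 3: a vanishing ℤ-combination of values
of weighted Walsh cells (0,1)^{dᵢ} ∩ {Pᵢ > 0} with deg Pᵢ ≤ 2 and dᵢ ≤ 3 is a relation. Tags: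
support · WEAKER (QuadricSignKernel ⟹ it by specialisation quadricThree_of_quadricSignKernel; S ⟹ it
quadricThree_of_summit) · ATTACKABLE-mod-Baker made LITERAL: reduced OUTRIGHT to the moves-only
support QuadricBakerDescent by the kernel-checked quadricThree_of_bakerDescent : BakerKernel →
QuadricBakerDescent → QuadricThree, BakerKernel = the tree theorem
PiBox.Dlog.mem_relations_of_eval_eq_zero_of_dim_le_one
(Theorems/HurwitzMicroSectorsNormalFormPrincipleDimOneAssembly.lean:345; input BY NAME, not an item;
identification bakerKernel_landed in WalshStrataLanded.lean once the module builds on the farm).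
Values met (census j337588, 7131 classes): ℚ + ℚπ + Σ ℚ̄ log ℚ̄. Why it might fail: cannot be refute -/
@[route_item "route-KontsevichZagierPeriods-RootDecompWalshStrata"]
def QuadricThree : Prop :=
  ∀ (k : ℕ) (d : Fin k → ℕ) (P : (i : Fin k) → MvPolynomial (Fin (d i)) ℚ) (q : Fin k → ℚ) (ρ : (i : Fin k) → Literature.NumberTheory.Transcendental.KZ.IntegralRep (d i)) (c : Fin k → ℤ), (∀ i, (ρ i).domain = {x | (∀ j, 0 < x j ∧ x j < 1) ∧ 0 < MvPolynomial.aeval x (P i)} ∧ ∀ x ∈ (ρ i).domain, (ρ i).integrand x = (q i : ℝ)) → (∀ i, (P i).totalDegree ≤ 2) → (∀ i, d i ≤ 3) → Literature.NumberTheory.Transcendental.KZ.eval (∑ i, c i • Literature.NumberTheory.Transcendental.KZ.of (ρ i)) = 0 → (∑ i, c i • Literature.NumberTheory.Transcendental.KZ.of (ρ i)) ∈ Literature.NumberTheory.Transcendental.KZ.relations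

/-- item stmt-KontsevichZagierPeriods-27597 · support · rank 9 · open · by planner
[support] [ROOT-DECOMP decomp-kz gen 3 · node D (route of record RootDecompWalshStrata) · lens-4
«WalshStrata» v3 @59ab03df l.1766 · critic decomp-kz-crit-1 CLEARED/CONFIRMED 2026-08-30T04:20:26Z
(w2): QUADRIC BAKER DESCENT — every weighted quadric Walsh cell (0,1)^d ∩ {P > 0}, deg P ≤ 2, d ≤ 3,
constant rational integrand, is congruent modulo KZ.relations to an element of the Baker sector =
AddSubgroup.closure{of N : dim N ≤ 1, N.IsRational}. Tags: support · MOVES-ONLY leaf of the rung d ≤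
3 (the lever, not a piece of the node: NOT formally S-implied — sector membership, not a value
coincidence; T1 n/a; absorbs nothing, implies no piece by itself) · ATTACKABLE (provable-now sketch
credible per critic: Newton–Leibniz along x₃, additivity, rational-point projection / Euler
substitution, genus 0 throughout; trivially true for d ≤ 1, content at d = 2, 3). First
kernel-checked instances IN THE LENS FILE (std axioms): coneRung_mem_relations
(3·[(0,1)³∩{z²>x²+y²},1] − [(0,1)³∩{1>x²+y²},1] ∈ KZ.relations, decided inside rules (1)–(3)) and
cone_bakerDescent ([cone,1] ≡ [(0,1), 8t²/(3(1+t²)³)] by six moves) = INSTRUMENT for the quadric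
stratum at d = 3. Why it might fail: a quadric over ℚ W -/
@[route_item "route-KontsevichZagierPeriods-RootDecompWalshStrata", crux]
def QuadricBakerDescent : Prop :=
  ∀ (d : ℕ) (P : MvPolynomial (Fin d) ℚ) (q : ℚ) (ρ : Literature.NumberTheory.Transcendental.KZ.IntegralRep d), (ρ.domain = {x | (∀ j, 0 < x j ∧ x j < 1) ∧ 0 < MvPolynomial.aeval x P} ∧ ∀ x ∈ ρ.domain, ρ.integrand x = (q : ℝ)) → P.totalDegree ≤ 2 → d ≤ 3 → ∃ y ∈ AddSubgroup.closure {y : Literature.NumberTheory.Transcendental.KZ.FormalRep | ∃ (m : ℕ) (N : Literature.NumberTheory.Transcendental.KZ.IntegralRep m), m ≤ 1 ∧ N.IsRational ∧ y = Literature.NumberTheory.Transcendental.KZ.of N}, Literature.NumberTheory.Transcendental.KZ.of ρ - y ∈ Literature.NumberTheory.Transcendental.KZ.relations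

/-- item stmt-KontsevichZagierPeriods-25396 · assembly · rank 1 · open · by planner
sources: KontsevichZagier2001
[assembly] WalshSpan → PlanarSignKernel → QuadricSignKernel → SignDescent → KontsevichZagierPeriods -/
@[route_item "route-KontsevichZagierPeriods-RootDecompWalshStrata"]
def Assembly : Prop :=
  WalshSpan → PlanarSignKernel → QuadricSignKernel → SignDescent → _root_.KontsevichZagierPeriods

/-! D-0027 §2.1 — DECIDING THEOREM (planner-authored via `route open/edit --closes-file`; by planner-decomp-kz-writer-1-g0-0 2026-08-30T02:33:41Z):
its hypotheses are this route's items and its conclusion the sub-problem Statement (glue_lint), and it elaborates with this file. -/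

@[closes "route-KontsevichZagierPeriods-RootDecompWalshStrata"] theorem closes (hW : WalshSpan) (hP : PlanarSignKernel) (hQ : QuadricSignKernel)
    (hD : SignDescent) : _root_.KontsevichZagierPeriods := by
  rw [KontsevichZagierPeriods_iff]
  intro n m r r' hr hr' hv
  obtain ⟨k, d, P, q, ρ, c, c', hcell, h1, h2⟩ := hW r r' hr hr'
  have e1 : Literature.NumberTheory.Transcendental.KZ.eval
      (∑ i, c i • Literature.NumberTheory.Transcendental.KZ.of (ρ i)) = r.value := by
    have := Literature.NumberTheory.Transcendental.KZ.relations_le_ker_eval_holds h1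
    rw [AddMonoidHom.mem_ker, map_sub, Literature.NumberTheory.Transcendental.KZ.eval_of,
      sub_eq_zero] at this
    exact this.symm
  have e2 : Literature.NumberTheory.Transcendental.KZ.eval
      (∑ i, c' i • Literature.NumberTheory.Transcendental.KZ.of (ρ i)) = r'.value := by
    have := Literature.NumberTheory.Transcendental.KZ.relations_le_ker_eval_holds h2
    rw [AddMonoidHom.mem_ker, map_sub, Literature.NumberTheory.Transcendental.KZ.eval_of,
      sub_eq_zero] at this
    exact this.symm
  have hg : (∑ i, (c i - c' i) • Literature.NumberTheory.Transcendental.KZ.of (ρ i)) =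
      (∑ i, c i • Literature.NumberTheory.Transcendental.KZ.of (ρ i)) -
        ∑ i, c' i • Literature.NumberTheory.Transcendental.KZ.of (ρ i) := by
    simp only [sub_smul, Finset.sum_sub_distrib]
  have hg0 : Literature.NumberTheory.Transcendental.KZ.eval
      (∑ i, (c i - c' i) • Literature.NumberTheory.Transcendental.KZ.of (ρ i)) = 0 := by
    rw [hg, map_sub, e1, e2, hv, sub_self]
  have hcl := hD k d P q ρ (fun i => c i - c' i) hcell hg0
  have hle : ∀ f, f ∈ AddSubgroup.closure
      ((Literature.NumberTheory.Transcendental.KZ.relations :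
          Set Literature.NumberTheory.Transcendental.KZ.FormalRep) ∪
        {f | ∃ (k' : ℕ) (d' : Fin k' → ℕ) (P' : (i : Fin k') → MvPolynomial (Fin (d' i)) ℚ)
          (q' : Fin k' → ℚ)
          (ρ' : (i : Fin k') → Literature.NumberTheory.Transcendental.KZ.IntegralRep (d' i))
          (c' : Fin k' → ℤ),
          (∀ i, (ρ' i).domain = {x | (∀ j, 0 < x j ∧ x j < 1) ∧ 0 < MvPolynomial.aeval x (P' i)} ∧
            ∀ x ∈ (ρ' i).domain, (ρ' i).integrand x = (q' i : ℝ)) ∧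
          ((∀ i, d' i ≤ 2) ∨ (∀ i, (P' i).totalDegree ≤ 2)) ∧
          Literature.NumberTheory.Transcendental.KZ.eval f = 0 ∧
          f = ∑ i, c' i • Literature.NumberTheory.Transcendental.KZ.of (ρ' i)}) →
      f ∈ Literature.NumberTheory.Transcendental.KZ.relations := by
    intro f hf
    refine (AddSubgroup.closure_le _).mpr ?_ hf
    rintro g (hg' | ⟨k', d', P', q', ρ', c'', hcell', hstrat, hev, rfl⟩)
    · exact hg'
    · rcases hstrat with hpl | hqu
      · exact hP k' d' P' q' ρ' c'' hcell' hpl hev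
      · exact hQ k' d' P' q' ρ' c'' hcell' hqu hev
  have hgR := hle _ hcl
  have key : Literature.NumberTheory.Transcendental.KZ.of r -
      Literature.NumberTheory.Transcendental.KZ.of r' =
      (Literature.NumberTheory.Transcendental.KZ.of r -
          ∑ i, c i • Literature.NumberTheory.Transcendental.KZ.of (ρ i)) -
        (Literature.NumberTheory.Transcendental.KZ.of r' -
          ∑ i, c' i • Literature.NumberTheory.Transcendental.KZ.of (ρ i)) +
        ∑ i, (c i - c' i) • Literature.NumberTheory.Transcendental.KZ.of (ρ i) := by
    rw [hg]; abel
  show Literature.NumberTheory.Transcendental.KZ.of r -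
      Literature.NumberTheory.Transcendental.KZ.of r' ∈
    Literature.NumberTheory.Transcendental.KZ.relations
  rw [key]
  exact add_mem (sub_mem h1 h2) hgR

end Summit.KontsevichZagierPeriods.KontsevichZagierPeriods.Theses.RootDecompWalshStrata
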